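import Mathlib
import Summits.NavierStokesRegularity.NavierStokesRegularity.Theorems.EulerZoomLiouvillePowerGaugeEulerLiouvilleRigidFramePairing
import HarnessLib

/-!
# RIGID FRAMES: continuity of the body-frame pairings `τ ↦ ∫⟪L(τ)U(w), G(R(τ)w + ξ(τ))⟫` and `τ ↦ ∫⟪R(τ)U(w), Ψ(R(τ)w + ξ(τ)) R(τ)U(w)⟫`
# (crux `EulerZoomLiouville.PowerGaugeEulerLiouville` = stmt-NavierStokesRegularity-19832; tools of the «E(3)-steady, escaping» stratum; width seat ns-ezl-w3 g5)

Route №10 `EulerZoomLiouville`, crux E.  Companions of `RigidFrame.continuous_integral_inner_rigid_clm_path` (`…RigidFramePairing.lean`): the two remaining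
continuity statements needed to read the tensor-tested weak Euler identity of a rigid-frame-steady member point-wise in time (by parts + the fundamental
lemma, `GalileanFrames.eq_of_integral_deriv_mul_add_eq_zero`): `RigidFrame.continuous_integral_inner_rigid_path` (linear, vector test field) and
`RigidFrame.continuous_integral_inner_rigid_clm_self` (quadratic in `U`, `|U|² ∈ L¹_loc`).  Dominated convergence with the moving support kept in
`‖w‖ ≤ R₀ + sup|ξ|` by the isometry property.

WHAT THIS IS NOT: not NS regularity, not the crux E — tools toward one more symmetry stratum of the crux CLASS 19832 (MODEL lattice; E/NS strata),
`--supports` stmt-19832; 19832 OPEN. [folklore]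
-/

noncomputable section

-- flat `Theorems/<Route><Decl>…` files of one crux share the namespace of the crux (tree convention: `Summit.<S>.<S>.…`)
set_option linter.dupNamespace false

open MeasureTheory Set Filter Topology Metric Function TopologicalSpace InnerProductSpace
open scoped ENNReal NNReal RealInnerProductSpace ContDiff

namespace Summit.NavierStokesRegularity.NavierStokesRegularity.Theorems.PowerGaugeEulerLiouville

namespace RigidFrame

open Literature.Analysis Literature.Analysis.FunctionSpaces Literature.Analysis.FluidPDE

variable {U : EuclideanSpace ℝ (Fin 3) → EuclideanSpace ℝ (Fin 3)} {ξ : ℝ → EuclideanSpace ℝ (Fin 3)}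
  {R : ℝ → EuclideanSpace ℝ (Fin 3) →L[ℝ] EuclideanSpace ℝ (Fin 3)}

/-- **Continuity of the linear body-frame pairing** `τ ↦ ∫ ⟪L(τ) U(w), G(R(τ)w + ξ(τ))⟫ dw` (`U ∈ L¹_loc`, `G` continuous with compact support,
`R` a continuous path of isometries, `L` a continuous operator path, `ξ` continuous). [folklore] -/
theorem continuous_integral_inner_rigid_path (hU : LocallyIntegrable U volume) (hξ : Continuous ξ)
    (hRc : Continuous R) (hRi : ∀ τ w, ‖R τ w‖ = ‖w‖)
    {L : ℝ → EuclideanSpace ℝ (Fin 3) →L[ℝ] EuclideanSpace ℝ (Fin 3)} (hL : Continuous L)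
    {G : EuclideanSpace ℝ (Fin 3) → EuclideanSpace ℝ (Fin 3)} (hG : Continuous G) (hGc : HasCompactSupport G) :
    Continuous fun τ : ℝ => ∫ w, ⟪L τ (U w), G (R τ w + ξ τ)⟫ := by
  refine continuous_iff_continuousAt.2 fun τ₀ => ?_
  obtain ⟨M₀, hM₀⟩ := hG.bounded_above_of_compact_support hGc
  have hM₀0 : 0 ≤ M₀ := (norm_nonneg _).trans (hM₀ 0)
  obtain ⟨R₀, hR₀0, hR₀⟩ := hGc.isCompact.isBounded.subset_closedBall_lt 0 (0 : EuclideanSpace ℝ (Fin 3))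
  obtain ⟨Mξ, hMξ⟩ := (isCompact_Icc (a := τ₀ - 1) (b := τ₀ + 1)).exists_bound_of_continuousOn hξ.continuousOn
  obtain ⟨ML, hML⟩ := (isCompact_Icc (a := τ₀ - 1) (b := τ₀ + 1)).exists_bound_of_continuousOn hL.continuousOn
  have hML0 : 0 ≤ ML := (norm_nonneg _).trans (hML τ₀ ⟨by linarith, by linarith⟩)
  have hball : ∀ t ∈ ball τ₀ (1 : ℝ), t ∈ Icc (τ₀ - 1) (τ₀ + 1) := fun t ht => by
    have h := mem_ball_iff_norm.1 ht
    rw [Real.norm_eq_abs, abs_lt] at h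
    exact ⟨by linarith, by linarith⟩
  set K : Set (EuclideanSpace ℝ (Fin 3)) := closedBall 0 (R₀ + Mξ) with hK
  have hKc : IsCompact K := isCompact_closedBall _ _
  set bound : EuclideanSpace ℝ (Fin 3) → ℝ := K.indicator fun w => ML * M₀ * ‖U w‖ with hbound
  have hbound_int : Integrable bound volume := by
    rw [hbound, integrable_indicator_iff hKc.measurableSet]
    exact ((hU.integrableOn_isCompact hKc).norm.const_mul (ML * M₀))
  have hF_meas : ∀ t : ℝ, AEStronglyMeasurable (fun w => ⟪L t (U w), G (R t w + ξ t)⟫) volume := fun t =>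
    ((L t).continuous.comp_aestronglyMeasurable hU.aestronglyMeasurable).inner
      (hG.comp ((R t).continuous.add continuous_const)).aestronglyMeasurable
  refine continuousAt_of_dominated (Eventually.of_forall hF_meas) ?_ hbound_int ?_
  · filter_upwards [ball_mem_nhds τ₀ one_pos] with t ht
    refine ae_of_all _ fun w => ?_
    have htI := hball t ht
    by_cases hw : w ∈ K
    · rw [hbound, indicator_of_mem hw]
      calc ‖⟪L t (U w), G (R t w + ξ t)⟫‖ ≤ ‖L t (U w)‖ * ‖G (R t w + ξ t)‖ := norm_inner_le_norm _ _
        _ ≤ (‖L t‖ * ‖U w‖) * M₀ := mul_le_mul ((L t).le_opNorm _) (hM₀ _) (norm_nonneg _) (by positivity)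
        _ ≤ (ML * ‖U w‖) * M₀ := mul_le_mul_of_nonneg_right (mul_le_mul_of_nonneg_right (hML t htI) (norm_nonneg _)) hM₀0
        _ = ML * M₀ * ‖U w‖ := by ring
    · have hG0 : G (R t w + ξ t) = 0 := by
        by_contra hne
        have h1 := norm_le_of_rigid_mem (hRi t) (mem_closedBall_zero_iff.1 (hR₀ (subset_tsupport _ (mem_support.2 hne))))
        exact hw (mem_closedBall_zero_iff.2 (h1.trans (by linarith [hMξ t htI])))
      rw [hbound, indicator_of_notMem hw, hG0]
      simp
  · refine ae_of_all _ fun w => ?_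
    have h1 : Continuous fun t : ℝ => L t (U w) := hL.clm_apply continuous_const
    have h2 : Continuous fun t : ℝ => R t w + ξ t := (hRc.clm_apply continuous_const).add hξ
    exact (h1.inner (hG.comp h2)).continuousAt

/-- **Continuity of the quadratic body-frame pairing** `τ ↦ ∫ ⟪R(τ)U(w), Ψ(R(τ)w + ξ(τ)) R(τ)U(w)⟫ dw` (`|U|² ∈ L¹_loc`). [folklore] -/
theorem continuous_integral_inner_rigid_clm_self (hUm : AEStronglyMeasurable U volume)
    (hU2 : LocallyIntegrable (fun z => ‖U z‖ ^ 2) volume) (hξ : Continuous ξ)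
    (hRc : Continuous R) (hRi : ∀ τ w, ‖R τ w‖ = ‖w‖)
    {Ψ : EuclideanSpace ℝ (Fin 3) → EuclideanSpace ℝ (Fin 3) →L[ℝ] EuclideanSpace ℝ (Fin 3)} (hΨ : Continuous Ψ)
    (hΨc : HasCompactSupport Ψ) :
    Continuous fun τ : ℝ => ∫ w, ⟪R τ (U w), Ψ (R τ w + ξ τ) (R τ (U w))⟫ := by
  refine continuous_iff_continuousAt.2 fun τ₀ => ?_
  obtain ⟨M₁, hM₁⟩ := hΨ.bounded_above_of_compact_support hΨc
  have hM₁0 : 0 ≤ M₁ := (norm_nonneg _).trans (hM₁ 0)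
  obtain ⟨R₀, hR₀0, hR₀⟩ := hΨc.isCompact.isBounded.subset_closedBall_lt 0 (0 : EuclideanSpace ℝ (Fin 3))
  obtain ⟨Mξ, hMξ⟩ := (isCompact_Icc (a := τ₀ - 1) (b := τ₀ + 1)).exists_bound_of_continuousOn hξ.continuousOn
  have hball : ∀ t ∈ ball τ₀ (1 : ℝ), t ∈ Icc (τ₀ - 1) (τ₀ + 1) := fun t ht => by
    have h := mem_ball_iff_norm.1 ht
    rw [Real.norm_eq_abs, abs_lt] at h
    exact ⟨by linarith, by linarith⟩
  set K : Set (EuclideanSpace ℝ (Fin 3)) := closedBall 0 (R₀ + Mξ) with hK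
  have hKc : IsCompact K := isCompact_closedBall _ _
  set bound : EuclideanSpace ℝ (Fin 3) → ℝ := K.indicator fun w => M₁ * ‖U w‖ ^ 2 with hbound
  have hbound_int : Integrable bound volume := by
    rw [hbound, integrable_indicator_iff hKc.measurableSet]
    exact ((hU2.integrableOn_isCompact hKc).const_mul M₁)
  have happ := (isBoundedBilinearMap_apply (𝕜 := ℝ) (E := EuclideanSpace ℝ (Fin 3)) (F := EuclideanSpace ℝ (Fin 3))).continuous
  have hF_meas : ∀ t : ℝ, AEStronglyMeasurable (fun w => ⟪R t (U w), Ψ (R t w + ξ t) (R t (U w))⟫) volume := by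
    intro t
    have h1 : AEStronglyMeasurable (fun w => R t (U w)) volume := (R t).continuous.comp_aestronglyMeasurable hUm
    exact h1.inner (happ.comp_aestronglyMeasurable
      ((hΨ.comp ((R t).continuous.add continuous_const)).aestronglyMeasurable.prodMk h1))
  refine continuousAt_of_dominated (Eventually.of_forall hF_meas) ?_ hbound_int ?_
  · filter_upwards [ball_mem_nhds τ₀ one_pos] with t ht
    refine ae_of_all _ fun w => ?_
    have htI := hball t ht
    by_cases hw : w ∈ K
    · rw [hbound, indicator_of_mem hw]
      calc ‖⟪R t (U w), Ψ (R t w + ξ t) (R t (U w))⟫‖ ≤ ‖R t (U w)‖ * ‖Ψ (R t w + ξ t) (R t (U w))‖ := norm_inner_le_norm _ _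
        _ ≤ ‖U w‖ * (M₁ * ‖U w‖) := by
            rw [hRi]
            gcongr
            exact (ContinuousLinearMap.le_opNorm _ _).trans (by rw [hRi]; exact mul_le_mul_of_nonneg_right (hM₁ _) (norm_nonneg _))
        _ = M₁ * ‖U w‖ ^ 2 := by ring
    · have hΨ0 : Ψ (R t w + ξ t) = 0 := by
        by_contra hne
        have h1 := norm_le_of_rigid_mem (hRi t) (mem_closedBall_zero_iff.1 (hR₀ (subset_tsupport _ (mem_support.2 hne))))
        exact hw (mem_closedBall_zero_iff.2 (h1.trans (by linarith [hMξ t htI])))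
      rw [hbound, indicator_of_notMem hw, hΨ0]
      simp
  · refine ae_of_all _ fun w => ?_
    have h1 : Continuous fun t : ℝ => R t (U w) := hRc.clm_apply continuous_const
    have h2 : Continuous fun t : ℝ => R t w + ξ t := (hRc.clm_apply continuous_const).add hξ
    exact (h1.inner ((hΨ.comp h2).clm_apply h1)).continuousAt

end RigidFrame

end Summit.NavierStokesRegularity.NavierStokesRegularity.Theorems.PowerGaugeEulerLiouville

end
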